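import Mathlib.GroupTheory.SemidirectProduct
import Mathlib.RepresentationTheory.Homological.GroupCohomology.LowDegree
import Mathlib.SetTheory.Cardinal.Finite
import Mathlib.Algebra.Quaternion
import Mathlib.Algebra.Star.Unitary
import Literature.Combinatorics.Additive.TripleProductProperty
import Literature.Computability.AlgebraicComplexity.CohnUmansTPP
import HarnessLib

/-!
# Cohn–Umans 2003, §7.1: the 1-cocycle construction of TPP triples in a semidirect product

Topic `Literature/Computability/AlgebraicComplexity` (group-theoretic matrix multiplication), namespace
`Literature.Computability.AlgebraicComplexity.CocycleTPP`.

H. Cohn, C. Umans, *A group-theoretic approach to fast matrix multiplication*, FOCS 2003 = arXiv:math/0307321,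
§7.1, the remark after Proposition 7.4 (Prop. 16 of the arXiv text, p. 9; the order-`80` Frobenius group
`C₅ ⋉ 𝔽₁₆` realizing `⟨5, 5, 8⟩`, tree `Frobenius80.CohnUmans2003_prop74`), verbatim:

> "This proposition generalizes as follows (see [Brown] for background on cohomology): Let `G` be a group that
> acts on an abelian group `A`, `θ : G → A` a `1`-cocycle, and `B ⊆ A` a subgroup. If `θ(g) ∈ B` implies `g = 1`
> for all `g ∈ G`, then the semidirect product `G ⋉ A` realizes `⟨|G|, |G|, |B|⟩` via the subgroups `G × {0}`,
> `{(g, θ(g)) : g ∈ G}`, and `{1} × B`. (In Proposition 7.4, the `1`-cocycle is a coboundary.) Unfortunately,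
> we do not know any other good examples."

(For subgroups `H₁, H₂, H₃` the triple product property of Def. 2.1 reads "`h₁ h₂ h₃ = 1` with `hᵢ ∈ Hᵢ`
forces `h₁ = h₂ = h₃ = 1`", since `Q(Hᵢ) = Hᵢ`; CU03 p. 3.)

## Lean rendering

Mathlib's semidirect product `N ⋊[φ] G` (`SemidirectProduct N G φ`, `φ : G →* MulAut N`, multiplication
`(n₁, g₁)(n₂, g₂) = (n₁ · φ g₁ n₂, g₁ g₂)`) is used, with `N` written multiplicatively.  The printed hypothesis
"`θ` is a `1`-cocycle" is exactly what makes `g ↦ (θ g, g)` a homomorphism `G →* N ⋊[φ] G` (a complement of `N`);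
in Mathlib's convention this is the crossed-homomorphism identity `θ(gh) = θ(g) · φ g (θ h)` (`cocycleSplitting`),
which for an abelian `A` with a `MulDistribMulAction` of `G` is Mathlib's `groupCohomology.IsMulCocycle₁ θ`
(`cocycle_of_isMulCocycle₁`).  We prove the statement for an ARBITRARY group `N` in place of the abelian `A`
(the printed proof — a one-line computation — does not use commutativity):

* `CohnUmans2003_cocycle_tpp` — the subgroup form: `(1, a) · (θ b, b) · (c, 1) = 1` with `c ∈ B` forces
  `a = b = 1`, `c = 1`;
* `CohnUmans2003_cocycle_subgroupTPP` — the same for the three subgroups `inr(G) = G × {1}`,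
  `{(θ g, g)}` = range of `cocycleSplitting`, `inl(B) = {1} × B` of `N ⋊[φ] G`;
* `CohnUmans2003_cocycle_realizes` — for finite `G` and `B`: `N ⋊[φ] G` realizes `⟨|G|, |G|, |B|⟩` in the
  tree's sense (`RealizesTPP`, the right-quotient TPP of CU03 Def. 2.1 / CKSU05 Def. 1.3 on the three finite
  sets);
* `CohnUmans2003_cocycle_realizes_of_isMulCocycle₁` — the printed abelian form (`A` abelian, `G` acting by a
  `MulDistribMulAction`, `θ` a `1`-cocycle in Mathlib's sense).

Proof of the TPP (ours, as the source gives none; one line): `(1,a)(θ b, b)(c, 1) = (φ a (θ b) · φ (ab) c, ab)`,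
so `ab = 1`; the cocycle identity at `(a, b)` gives `θ 1 = 1 = θ a · φ a (θ b)`, whence `θ a = c ∈ B`, `a = 1`,
then `b = 1` and `c = θ 1 = 1`.

## References
* H. Cohn, C. Umans, FOCS 2003, 438–449; arXiv:math/0307321, §7.1, remark after Prop. 7.4 (after Prop. 16 of
  the arXiv text, p. 9); Def. 2.1 (p. 3). [CohnUmans2003]
-/

namespace Literature.Computability.AlgebraicComplexity

namespace CocycleTPP

open Finset Literature.Combinatorics.Additive

variable {N G : Type*} [Group N] [Group G] {φ : G →* MulAut N}

/-- The value of a crossed homomorphism at `1` is `1`. [cite: CohnUmans2003, §7.1 (remark after Prop. 7.4)] -/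
theorem cocycle_one {θ : G → N} (hθ : ∀ g h, θ (g * h) = θ g * φ g (θ h)) : θ 1 = 1 := by
  have h := hθ 1 1
  rw [mul_one, map_one, MulAut.one_apply, left_eq_mul] at h
  exact h

/-- **The splitting defined by a `1`-cocycle**: for `θ : G → N` with `θ(gh) = θ(g) · φ g (θ h)` the map
`g ↦ (θ g, g)` is a homomorphism `G →* N ⋊[φ] G`; its range is the subgroup `{(θ g, g) : g ∈ G}` of the printed
statement. [cite: CohnUmans2003, §7.1 (remark after Prop. 7.4)] -/
def cocycleSplitting (θ : G → N) (hθ : ∀ g h, θ (g * h) = θ g * φ g (θ h)) : G →* N ⋊[φ] G where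
  toFun g := ⟨θ g, g⟩
  map_one' := SemidirectProduct.ext (cocycle_one hθ) rfl
  map_mul' g h := SemidirectProduct.ext (by simp only [SemidirectProduct.mul_left, hθ g h])
    (by simp only [SemidirectProduct.mul_right])

/-- First coordinate of the splitting: `θ g`. [cite: CohnUmans2003, §7.1 (remark after Prop. 7.4)] -/
@[simp] theorem cocycleSplitting_left (θ : G → N) (hθ : ∀ g h, θ (g * h) = θ g * φ g (θ h)) (g : G) :
    (cocycleSplitting θ hθ g).left = θ g := rfl

/-- Second coordinate of the splitting: `g`. [cite: CohnUmans2003, §7.1 (remark after Prop. 7.4)] -/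
@[simp] theorem cocycleSplitting_right (θ : G → N) (hθ : ∀ g h, θ (g * h) = θ g * φ g (θ h)) (g : G) :
    (cocycleSplitting θ hθ g).right = g := rfl

/-- `cocycleSplitting θ` is injective (its second coordinate is the identity).
[cite: CohnUmans2003, §7.1 (remark after Prop. 7.4)] -/
theorem cocycleSplitting_injective (θ : G → N) (hθ : ∀ g h, θ (g * h) = θ g * φ g (θ h)) :
    Function.Injective (cocycleSplitting θ hθ) := fun a b h => by
  simpa only [cocycleSplitting_right] using congrArg SemidirectProduct.right h

/-- **Cohn–Umans 2003, §7.1 (the `1`-cocycle construction), subgroup form of the triple product property.**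
If `θ(g) ∈ B` only for `g = 1`, then `(1, a) · (θ b, b) · (c, 1) = 1` with `a, b ∈ G`, `c ∈ B` forces
`a = 1`, `b = 1`, `c = 1`.  (Printed for an abelian `A`; the computation needs no commutativity.)
[cite: CohnUmans2003, §7.1 (remark after Prop. 7.4; arXiv p. 9)] -/
theorem CohnUmans2003_cocycle_tpp (θ : G → N) (hθ : ∀ g h, θ (g * h) = θ g * φ g (θ h)) (B : Subgroup N)
    (hB : ∀ g, θ g ∈ B → g = 1) {a b : G} {c : N} (hc : c ∈ B)
    (h : SemidirectProduct.inr a * cocycleSplitting θ hθ b * SemidirectProduct.inl c = 1) :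
    a = 1 ∧ b = 1 ∧ c = 1 := by
  have hr := congrArg SemidirectProduct.right h
  have hl := congrArg SemidirectProduct.left h
  simp only [SemidirectProduct.mul_right, SemidirectProduct.right_inr, cocycleSplitting_right,
    SemidirectProduct.right_inl, mul_one, SemidirectProduct.one_right] at hr
  simp only [SemidirectProduct.mul_left, SemidirectProduct.left_inr, cocycleSplitting_left, one_mul,
    SemidirectProduct.mul_right, SemidirectProduct.right_inr, cocycleSplitting_right, hr, map_one,
    MulAut.one_apply, SemidirectProduct.left_inl, SemidirectProduct.one_left] at hl
  -- the cocycle identity at `(a, b)`: `1 = θ 1 = θ a · φ a (θ b)`, so `φ a (θ b) = (θ a)⁻¹`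
  have hab : φ a (θ b) = (θ a)⁻¹ := by
    have h1 : θ a * φ a (θ b) = 1 := by rw [← hθ a b, hr, cocycle_one hθ]
    exact eq_inv_of_mul_eq_one_right h1
  rw [hab, inv_mul_eq_one] at hl
  -- `θ a = c ∈ B` forces `a = 1`, then `b = 1` and `c = θ 1 = 1`
  have ha : a = 1 := hB a (hl ▸ hc)
  subst ha
  rw [one_mul] at hr
  subst hr
  exact ⟨rfl, rfl, by rw [← hl, cocycle_one hθ]⟩

/-- **Cohn–Umans 2003, §7.1, the three subgroups.**  With `H₁ = G × {1}` (`= inr(G)`), `H₂ = {(θ g, g)}`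
(`=` range of `cocycleSplitting θ`), `H₃ = {1} × B` (`= inl(B)`) in `N ⋊[φ] G`: if `θ(g) ∈ B` only for `g = 1`
then `h₁ h₂ h₃ = 1` with `hᵢ ∈ Hᵢ` forces `h₁ = h₂ = h₃ = 1` — the triple product property of three subgroups
(CU03 Def. 2.1 with `Q(Hᵢ) = Hᵢ`). [cite: CohnUmans2003, §7.1 (remark after Prop. 7.4; arXiv p. 9)] -/
theorem CohnUmans2003_cocycle_subgroupTPP (θ : G → N) (hθ : ∀ g h, θ (g * h) = θ g * φ g (θ h))
    (B : Subgroup N) (hB : ∀ g, θ g ∈ B → g = 1) {h₁ h₂ h₃ : N ⋊[φ] G}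
    (m₁ : h₁ ∈ (SemidirectProduct.inr : G →* N ⋊[φ] G).range) (m₂ : h₂ ∈ (cocycleSplitting θ hθ).range)
    (m₃ : h₃ ∈ B.map (SemidirectProduct.inl : N →* N ⋊[φ] G)) (h : h₁ * h₂ * h₃ = 1) :
    h₁ = 1 ∧ h₂ = 1 ∧ h₃ = 1 := by
  obtain ⟨a, rfl⟩ := m₁
  obtain ⟨b, rfl⟩ := m₂
  obtain ⟨c, hc, rfl⟩ := m₃
  obtain ⟨rfl, rfl, rfl⟩ := CohnUmans2003_cocycle_tpp θ hθ B hB hc h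
  exact ⟨map_one _, map_one _, map_one _⟩

/-- Transfer: three homomorphisms into a group whose "product equals one" equation has only the trivial solution
give three finite images with the tree's (right-quotient) triple product property — for subgroups `Q(H) = H`
(CU03, remark after Def. 2.1). [cite: CohnUmans2003, Def. 2.1 (remark after it)] -/
theorem tripleProductProperty_image_of_homs {K₁ K₂ K₃ H : Type*} [Group K₁] [Group K₂] [Group K₃] [Group H]
    [Fintype K₁] [Fintype K₂] [Fintype K₃] [DecidableEq H] (f₁ : K₁ →* H) (f₂ : K₂ →* H) (f₃ : K₃ →* H)
    (hf : ∀ a b c, f₁ a * f₂ b * f₃ c = 1 → a = 1 ∧ b = 1 ∧ c = 1) :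
    TripleProductProperty (univ.image f₁) (univ.image f₂) (univ.image f₃) := by
  intro s hs s' hs' t ht t' ht' u hu u' hu' heq
  obtain ⟨a, -, rfl⟩ := mem_image.1 hs
  obtain ⟨a', -, rfl⟩ := mem_image.1 hs'
  obtain ⟨b, -, rfl⟩ := mem_image.1 ht
  obtain ⟨b', -, rfl⟩ := mem_image.1 ht'
  obtain ⟨c, -, rfl⟩ := mem_image.1 hu
  obtain ⟨c', -, rfl⟩ := mem_image.1 hu'
  have key : f₁ (a * a'⁻¹) * f₂ (b * b'⁻¹) * f₃ (c * c'⁻¹) = 1 := by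
    simpa only [map_mul, map_inv] using heq
  obtain ⟨h1, h2, h3⟩ := hf _ _ _ key
  exact ⟨by rw [mul_inv_eq_one.1 h1], by rw [mul_inv_eq_one.1 h2], by rw [mul_inv_eq_one.1 h3]⟩

/-- **Cohn–Umans 2003, §7.1: `G ⋉ A` realizes `⟨|G|, |G|, |B|⟩`.**  For a finite group `G` acting on a group
`N` through `φ`, a map `θ : G → N` with `θ(gh) = θ(g) · φ g (θ h)` (a `1`-cocycle) and a finite subgroup
`B ≤ N` with `θ(g) ∈ B ⟹ g = 1`, the semidirect product `N ⋊[φ] G` realizes `⟨|G|, |G|, |B|⟩` through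
`G × {1}`, `{(θ g, g)}`, `{1} × B` (tree `RealizesTPP`).  Printed for abelian `N = A`; see
`CohnUmans2003_cocycle_realizes_of_isMulCocycle₁` for that literal form.
[cite: CohnUmans2003, §7.1 (remark after Prop. 7.4; arXiv p. 9)] -/
theorem CohnUmans2003_cocycle_realizes [Finite G] (θ : G → N) (hθ : ∀ g h, θ (g * h) = θ g * φ g (θ h))
    (B : Subgroup N) [Finite B] (hB : ∀ g, θ g ∈ B → g = 1) :
    RealizesTPP (N ⋊[φ] G) (Nat.card G) (Nat.card G) (Nat.card B) := by
  classical
  letI : Fintype G := Fintype.ofFinite G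
  letI : Fintype B := Fintype.ofFinite B
  have h1 : Function.Injective (SemidirectProduct.inr : G →* N ⋊[φ] G) := SemidirectProduct.inr_injective
  have h2 := cocycleSplitting_injective θ hθ
  have h3 : Function.Injective ((SemidirectProduct.inl : N →* N ⋊[φ] G).comp B.subtype) :=
    SemidirectProduct.inl_injective.comp Subtype.val_injective
  refine ⟨univ.image (SemidirectProduct.inr : G →* N ⋊[φ] G), univ.image (cocycleSplitting θ hθ),
    univ.image ((SemidirectProduct.inl : N →* N ⋊[φ] G).comp B.subtype), ?_, ?_, ?_,
    tripleProductProperty_image_of_homs _ _ _ fun a b c h => ?_⟩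
  · rw [card_image_of_injective _ h1, card_univ, Nat.card_eq_fintype_card]
  · rw [card_image_of_injective _ h2, card_univ, Nat.card_eq_fintype_card]
  · rw [card_image_of_injective _ h3, card_univ, Nat.card_eq_fintype_card]
  · obtain ⟨ha, hb, hc⟩ := CohnUmans2003_cocycle_tpp θ hθ B hB c.2 h
    exact ⟨ha, hb, Subtype.ext hc⟩

/-! ### The printed abelian form: `A` abelian, `θ` a `1`-cocycle in Mathlib's sense -/

section Abelian

variable {A : Type*} [CommGroup A] [MulDistribMulAction G A]

/-- For an abelian group `A` on which `G` acts (the action homomorphism `G →* MulAut A` being Mathlib's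
`MulDistribMulAction.toMulAut G A`), Mathlib's `1`-cocycle condition `θ(gh) = g • θ(h) · θ(g)`
(`groupCohomology.IsMulCocycle₁`) is the crossed-homomorphism identity used above.
[cite: CohnUmans2003, §7.1 (remark after Prop. 7.4: "θ : G → A a 1-cocycle")] -/
theorem cocycle_of_isMulCocycle₁ {θ : G → A} (hθ : groupCohomology.IsMulCocycle₁ θ) (g h : G) :
    θ (g * h) = θ g * MulDistribMulAction.toMulAut G A g (θ h) := by
  rw [hθ g h, mul_comm]; rfl

/-- **Cohn–Umans 2003, §7.1, as printed**: "Let `G` be a group that acts on an abelian group `A`, `θ : G → A` a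
`1`-cocycle, and `B ⊆ A` a subgroup. If `θ(g) ∈ B` implies `g = 1` for all `g ∈ G`, then the semidirect product
`G ⋉ A` realizes `⟨|G|, |G|, |B|⟩` via the subgroups `G × {0}`, `{(g, θ(g)) : g ∈ G}`, and `{1} × B`."
(`G`, `B` finite so that the three cardinalities are numbers; `A` written multiplicatively, the semidirect
product being Mathlib's `A ⋊[MulDistribMulAction.toMulAut G A] G`.)
[cite: CohnUmans2003, §7.1 (remark after Prop. 7.4; arXiv p. 9)] -/
theorem CohnUmans2003_cocycle_realizes_of_isMulCocycle₁ [Finite G] {θ : G → A}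
    (hθ : groupCohomology.IsMulCocycle₁ θ) (B : Subgroup A) [Finite B] (hB : ∀ g, θ g ∈ B → g = 1) :
    RealizesTPP (A ⋊[MulDistribMulAction.toMulAut G A] G) (Nat.card G) (Nat.card G) (Nat.card B) :=
  CohnUmans2003_cocycle_realizes θ (cocycle_of_isMulCocycle₁ hθ) B hB

end Abelian

/-! ### The `U ⋉ ℍ` example (unit quaternions) -/

section Quaternion

open Quaternion

/-- Cohn–Umans' second instance of the construction (§7.1, after Prop. 7.4): "Let `ℍ` be the quaternions, and
`U ⊂ ℍ^×` be the group of unit quaternions (which is isomorphic to `SU(2)`). Then within the semidirect product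
`U ⋉ ℍ` …".  Left multiplication by a unit quaternion `u` (Mathlib: `u ∈ unitary ℍ[ℝ]`, i.e. `ū u = u ū = 1`) as an
automorphism of the additive group of `ℍ`, written multiplicatively. [cite: CohnUmans2003, §7.1 (the U ⋉ ℍ example)] -/
noncomputable def quatAut (u : unitary ℍ[ℝ]) : MulAut (Multiplicative ℍ[ℝ]) where
  toFun x := Multiplicative.ofAdd ((u : ℍ[ℝ]) * x.toAdd)
  invFun x := Multiplicative.ofAdd (star (u : ℍ[ℝ]) * x.toAdd)
  left_inv x := by simp [← mul_assoc, Unitary.star_mul_self_of_mem u.prop]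
  right_inv x := by simp [← mul_assoc, Unitary.mul_star_self_of_mem u.prop]
  map_mul' x y := by simp [mul_add]

/-- `quatAut u` is `x ↦ u x`. [cite: CohnUmans2003, §7.1 (the U ⋉ ℍ example)] -/
@[simp] theorem quatAut_apply (u : unitary ℍ[ℝ]) (x : Multiplicative ℍ[ℝ]) :
    quatAut u x = Multiplicative.ofAdd ((u : ℍ[ℝ]) * x.toAdd) := rfl

/-- The action `U →* Aut(ℍ, +)` by left multiplication defining `U ⋉ ℍ`.
[cite: CohnUmans2003, §7.1 (the U ⋉ ℍ example)] -/
noncomputable def quatAct : unitary ℍ[ℝ] →* MulAut (Multiplicative ℍ[ℝ]) where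
  toFun := quatAut
  map_one' := MulEquiv.ext fun x => by simp
  map_mul' u v := MulEquiv.ext fun x => by simp [mul_assoc]

/-- `quatAct u` is `x ↦ u x`. [cite: CohnUmans2003, §7.1 (the U ⋉ ℍ example)] -/
@[simp] theorem quatAct_apply (u : unitary ℍ[ℝ]) (x : Multiplicative ℍ[ℝ]) :
    quatAct u x = Multiplicative.ofAdd ((u : ℍ[ℝ]) * x.toAdd) := rfl

/-- The printed cocycle `θ(u) = u − 1` (a coboundary). [cite: CohnUmans2003, §7.1 (the U ⋉ ℍ example)] -/
noncomputable def quatCocycle (u : unitary ℍ[ℝ]) : Multiplicative ℍ[ℝ] := Multiplicative.ofAdd ((u : ℍ[ℝ]) - 1)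

/-- `θ(u) = u − 1`, unfolded. [cite: CohnUmans2003, §7.1 (the U ⋉ ℍ example)] -/
@[simp] theorem toAdd_quatCocycle (u : unitary ℍ[ℝ]) : (quatCocycle u).toAdd = (u : ℍ[ℝ]) - 1 := rfl

/-- `θ(uv) = θ(u) + u θ(v)`: `uv − 1 = (u − 1) + u(v − 1)`. [cite: CohnUmans2003, §7.1 (the U ⋉ ℍ example)] -/
theorem quatCocycle_mul (u v : unitary ℍ[ℝ]) :
    quatCocycle (u * v) = quatCocycle u * quatAct u (quatCocycle v) := by
  apply Multiplicative.toAdd.injective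
  simp only [toAdd_quatCocycle, Submonoid.coe_mul, toAdd_mul, quatAct_apply, toAdd_ofAdd, mul_sub, mul_one]
  abel

/-- The trace-zero quaternions `{x : Tr x = x + x̄ = 2 Re x = 0}` as a subgroup of `(ℍ, +)` (written
multiplicatively). [cite: CohnUmans2003, §7.1 (the U ⋉ ℍ example: "{(0,x) : Tr x = 0}")] -/
def traceZeroQuat : Subgroup (Multiplicative ℍ[ℝ]) where
  carrier := {x | (Multiplicative.toAdd x).re = 0}
  mul_mem' {x y} hx hy := by
    simp only [Set.mem_setOf_eq, toAdd_mul, Quaternion.re_add] at hx hy ⊢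
    rw [hx, hy, add_zero]
  one_mem' := by simp
  inv_mem' {x} hx := by
    simp only [Set.mem_setOf_eq, toAdd_inv, Quaternion.re_neg] at hx ⊢
    rw [hx, neg_zero]

/-- Membership in the trace-zero subgroup: `Re x = 0`. [cite: CohnUmans2003, §7.1 (the U ⋉ ℍ example)] -/
@[simp] theorem mem_traceZeroQuat {x : Multiplicative ℍ[ℝ]} :
    x ∈ traceZeroQuat ↔ (Multiplicative.toAdd x).re = 0 := Iff.rfl

/-- The hypothesis of the construction for `U ⋉ ℍ`: a unit quaternion `u` with `Tr(u − 1) = 0`, i.e.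
`Re u = 1`, is `1` (as `|u|² = (Re u)² + |Im u|² = 1`). [cite: CohnUmans2003, §7.1 (the U ⋉ ℍ example)] -/
theorem eq_one_of_quatCocycle_mem (u : unitary ℍ[ℝ]) (h : quatCocycle u ∈ traceZeroQuat) : u = 1 := by
  rw [mem_traceZeroQuat, toAdd_quatCocycle, Quaternion.re_sub, Quaternion.re_one, sub_eq_zero] at h
  have hn : Quaternion.normSq (u : ℍ[ℝ]) = 1 := by
    have h1 := Unitary.coe_star_mul_self u
    rw [Quaternion.star_mul_self, ← Quaternion.coe_one, Quaternion.coe_inj] at h1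
    exact h1
  rw [Quaternion.normSq_def'] at hn
  have hre : (u : ℍ[ℝ]).re = 1 := h
  have hI : (u : ℍ[ℝ]).imI = 0 := by
    nlinarith [sq_nonneg (u : ℍ[ℝ]).imI, sq_nonneg (u : ℍ[ℝ]).imJ, sq_nonneg (u : ℍ[ℝ]).imK]
  have hJ : (u : ℍ[ℝ]).imJ = 0 := by
    nlinarith [sq_nonneg (u : ℍ[ℝ]).imI, sq_nonneg (u : ℍ[ℝ]).imJ, sq_nonneg (u : ℍ[ℝ]).imK]
  have hK : (u : ℍ[ℝ]).imK = 0 := by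
    nlinarith [sq_nonneg (u : ℍ[ℝ]).imI, sq_nonneg (u : ℍ[ℝ]).imJ, sq_nonneg (u : ℍ[ℝ]).imK]
  apply Subtype.ext
  rw [OneMemClass.coe_one]
  exact Quaternion.ext _ _ (by rw [hre, Quaternion.re_one]) (by rw [hI, Quaternion.imI_one])
    (by rw [hJ, Quaternion.imJ_one]) (by rw [hK, Quaternion.imK_one])

/-- **Cohn–Umans 2003, §7.1, the `U ⋉ ℍ` example**: "within the semidirect product `U ⋉ ℍ`, the three subgroups
`U × {0}`, `{(u, u − 1) : u ∈ U}`, and `{(0, x) : Tr x = 0}` satisfy the triple product property" — subgroup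
form: `(0, u) · (v − 1, v) · (x, 1) = 1` with `Tr x = 0` forces `u = v = 1`, `x = 0`.  (The printed consequence
"Lie pseudo-exponent at most `(3 + 4)/3 = 7/3`" is a dimension count, Def. 6.1, and is not restated.)
[cite: CohnUmans2003, §7.1 (the U ⋉ ℍ example, arXiv p. 9)] -/
theorem CohnUmans2003_quaternion_tpp {u v : unitary ℍ[ℝ]} {x : ℍ[ℝ]} (hx : x.re = 0)
    (h : SemidirectProduct.inr u * cocycleSplitting quatCocycle quatCocycle_mul v *
      SemidirectProduct.inl (Multiplicative.ofAdd x) = (1 : Multiplicative ℍ[ℝ] ⋊[quatAct] unitary ℍ[ℝ])) :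
    u = 1 ∧ v = 1 ∧ x = 0 := by
  have hc : Multiplicative.ofAdd x ∈ traceZeroQuat := by simpa using hx
  obtain ⟨hu, hv, hx0⟩ := CohnUmans2003_cocycle_tpp quatCocycle quatCocycle_mul traceZeroQuat
    eq_one_of_quatCocycle_mem hc h
  exact ⟨hu, hv, by simpa using congrArg Multiplicative.toAdd hx0⟩

/-- The same for the three subgroups `U × {0} = inr(U)`, `{(u − 1, u)} =` range of the cocycle splitting,
`{Tr = 0} × {1} = inl(traceZeroQuat)` of `ℍ ⋊ U`: `h₁ h₂ h₃ = 1` with `hᵢ ∈ Hᵢ` forces `h₁ = h₂ = h₃ = 1`.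
[cite: CohnUmans2003, §7.1 (the U ⋉ ℍ example, arXiv p. 9)] -/
theorem CohnUmans2003_quaternion_subgroupTPP {h₁ h₂ h₃ : Multiplicative ℍ[ℝ] ⋊[quatAct] unitary ℍ[ℝ]}
    (m₁ : h₁ ∈ (SemidirectProduct.inr : unitary ℍ[ℝ] →* _).range)
    (m₂ : h₂ ∈ (cocycleSplitting quatCocycle quatCocycle_mul).range)
    (m₃ : h₃ ∈ traceZeroQuat.map (SemidirectProduct.inl : Multiplicative ℍ[ℝ] →* _)) (h : h₁ * h₂ * h₃ = 1) :
    h₁ = 1 ∧ h₂ = 1 ∧ h₃ = 1 :=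
  CohnUmans2003_cocycle_subgroupTPP quatCocycle quatCocycle_mul traceZeroQuat eq_one_of_quatCocycle_mem
    m₁ m₂ m₃ h

end Quaternion

end CocycleTPP

end Literature.Computability.AlgebraicComplexity
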